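import Literature.NumberTheory.EllipticCurves.ZpExtensionEisensteinDVRSettingH4FbarProofs
import Literature.NumberTheory.EllipticCurves.ZpExtensionEisensteinSelmerStructureProofs
import Literature.NumberTheory.GaloisCohomology.Howard2004.DualityDatumLocalCupAnnihilatorLeftProofs
import HarnessLib

/-!
# The transported strict ordinary cores are stable under the scalar action (proofs)

`Proofs` file (theorems only; no definition, no named fact, no instance, no `sorry`).  For the curve's Eisenstein tower
`T^{(j)} = E_K[p^{j+1}] ⊗ A_{m,j+1}(ψ)` (`W.eisensteinTower κ hm`), a conjugation datum `cd` and an ordinary filtration `Φ` at the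
conjugate place `cd.σ • v`, the TRANSPORTED strict ordinary cores
`C′_j := (Φ.ordinaryCore hm (j+1)).map (cd.transportH1 T^{(j)} v) ≤ H¹(K_v, Tw T^{(j)})` are stable under the scalar action
`H¹(c •)` of `A_{m,j+1}` on `H¹(K_v, Tw T^{(j)})` — the hypothesis `hC′` of the `X`-side of (EXACT-REP)
(`eisensteinTower_exists_sub_pow_smul_forall_localCup_flip_eq_zero`, x9-p1-w2 g8) at the cores of the D1 frame term
`HeegnerMuPartH4AtS.Stmt.exactRepAtP` (conjunct 2).  Two ingredients, both in the tree: the naturality of the transport in the module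
(`ConjugationDatum.transportH1_map_localMap`, at the scalar intertwining `c •`) and the `A_{m,k}`-stability of the strict cores
(`OrdinaryFiltration.scalarMapH1_mem_ordinaryCore`).

Cell `pub/bsd-print-x9` (shared μ-crux `MuInequalityCoherentPairOfPrintCG`, STUB A `stub_exactAtP`).  No summit statement is proved
here; BSD is not proved by any of this.  References: [Howard2004HeegnerKolyvagin] §1.3 (Tw, arXiv:1202.6340 p. 7 L44–48), §3.1
(`Fil_v T_𝔮` is an `S_𝔮`-submodule), Def. 3.2.5–3.2.6; [GreenbergLNM1716] §2; [SerreGaloisCohomology1997] I §2.2, §2.4.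
-/

set_option autoImplicit false

noncomputable section

open Function NumberField IsDedekindDomain Field CategoryTheory
open scoped NumberField ContRepresentation

namespace WeierstrassCurve

open Literature.NumberTheory.EllipticCurves Literature.NumberTheory.GaloisRepresentations
open Literature.NumberTheory.GaloisRepresentations.DiscreteGaloisModule
open Literature.NumberTheory.GaloisCohomology Literature.NumberTheory.GaloisCohomology.Howard2004

variable {K : Type} [Field K] [NumberField K] (W : WeierstrassCurve ℚ) [W.IsElliptic] {p : ℕ} [hp : Fact p.Prime]
  (κ : ZpExtension K p) {m : ℕ} (hm : 1 ≤ m) (cd : ConjugationDatum K)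

/-- **The transport commutes with the scalar action**: `transport_v (c • x) = c • transport_v x` for `x ∈ H¹(K_{σv}, T^{(j)})`,
`c ∈ A_{m,j+1}` (naturality of `cd.transportH1` at the scalar intertwining `c •`).
[cite: Howard2004HeegnerKolyvagin, §1.3 (Tw T, arXiv p. 7 L44–48)] [cite: SerreGaloisCohomology1997, Ch. I §2.4 (compatible pairs)] -/
theorem transportH1_scalarMapH1_eisensteinTower (v : HeightOneSpectrum (𝓞 K)) (j : ℕ)
    (c : IwasawaAlgebra.EisensteinCoeff p m (j + 1))
    (x : letI := IwasawaAlgebra.isLocalRing_quotient_X_pow_add_C p hm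
      galoisCohomology (((W.eisensteinTower κ hm).ρ j).toLocal (Sum.inr (cd.σ • v))) 1) :
    letI := IwasawaAlgebra.isLocalRing_quotient_X_pow_add_C p hm
    cd.transportH1 ((W.eisensteinTower κ hm).ρ j) v
        (galoisCohomology.scalarMapH1 (((W.eisensteinTower κ hm).ρ j).toLocal (Sum.inr (cd.σ • v)))
          (DualityDatum.isScalarLinear_toLocal
            (κ.isScalarLinear_eisensteinAdicTowerSucc_coeff (fun j ↦ (W.baseChange K).torsionGaloisModule ((p : ℤ) ^ j))
              (fun j ↦ (W.baseChange K).torsionGaloisModuleReduce p j) hm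
              (fun j ↦ (W.baseChange K).torsionGaloisModuleReduce_surjective p j) j) (Sum.inr (cd.σ • v))) c x) =
      galoisCohomology.scalarMapH1 ((cd.twist ((W.eisensteinTower κ hm).ρ j)).toLocal (Sum.inr v))
        (DualityDatum.isScalarLinear_twist_toLocal cd
          (κ.isScalarLinear_eisensteinAdicTowerSucc_coeff (fun j ↦ (W.baseChange K).torsionGaloisModule ((p : ℤ) ^ j))
            (fun j ↦ (W.baseChange K).torsionGaloisModuleReduce p j) hm
            (fun j ↦ (W.baseChange K).torsionGaloisModuleReduce_surjective p j) j) (Sum.inr v)) c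
        (cd.transportH1 ((W.eisensteinTower κ hm).ρ j) v x) := by
  letI := IwasawaAlgebra.isLocalRing_quotient_X_pow_add_C p hm
  exact cd.transportH1_map_localMap ((W.eisensteinTower κ hm).ρ j) ((W.eisensteinTower κ hm).ρ j)
    (DiscreteGaloisModule.scalarIntertwining ((W.eisensteinTower κ hm).ρ j)
      (κ.isScalarLinear_eisensteinAdicTowerSucc_coeff (fun j ↦ (W.baseChange K).torsionGaloisModule ((p : ℤ) ^ j))
        (fun j ↦ (W.baseChange K).torsionGaloisModuleReduce p j) hm
        (fun j ↦ (W.baseChange K).torsionGaloisModuleReduce_surjective p j) j) c) v x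

/-- **The transported strict ordinary cores are `A_{m,j+1}`-stable**: for an ordinary filtration `Φ` at the conjugate place `σ • v`,
the image `C′_j = transport_v (H¹_ord(K_{σv}, T^{(j)}))` of the strict core in `H¹(K_v, Tw T^{(j)})` is stable under `H¹(c •)`,
`c ∈ A_{m,j+1}` — the hypothesis `hC′` of the `X`-side of (EXACT-REP) at the cores of conjunct 2 of `Stmt.exactRepAtP`.
[cite: Howard2004HeegnerKolyvagin, §3.1 (Fil_v T_𝔮 is an S_𝔮-submodule) and Def. 3.2.5–3.2.6] [cite: GreenbergLNM1716, §2 (ordinary condition)] -/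
theorem scalarMapH1_mem_map_transportH1_ordinaryCore (v : HeightOneSpectrum (𝓞 K))
    (Φ : ZpExtension.OrdinaryFiltration (fun j ↦ (W.baseChange K).torsionGaloisModule ((p : ℤ) ^ j))
      (fun j ↦ (W.baseChange K).torsionGaloisModuleReduce p j) (cd.σ • v))
    (j : ℕ) (c : IwasawaAlgebra.EisensteinCoeff p m (j + 1))
    (y : letI := IwasawaAlgebra.isLocalRing_quotient_X_pow_add_C p hm
      galoisCohomology ((cd.twist ((W.eisensteinTower κ hm).ρ j)).toLocal (Sum.inr v)) 1)
    (hy : letI := IwasawaAlgebra.isLocalRing_quotient_X_pow_add_C p hm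
      y ∈ (Φ.ordinaryCore hm (j + 1)).map
        (cd.transportH1 (κ.eisensteinTwist ((W.baseChange K).torsionGaloisModule ((p : ℤ) ^ (j + 1))) hm (j + 1)) v)) :
    letI := IwasawaAlgebra.isLocalRing_quotient_X_pow_add_C p hm
    galoisCohomology.scalarMapH1 ((cd.twist ((W.eisensteinTower κ hm).ρ j)).toLocal (Sum.inr v))
        (DualityDatum.isScalarLinear_twist_toLocal cd
          (κ.isScalarLinear_eisensteinAdicTowerSucc_coeff (fun j ↦ (W.baseChange K).torsionGaloisModule ((p : ℤ) ^ j))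
            (fun j ↦ (W.baseChange K).torsionGaloisModuleReduce p j) hm
            (fun j ↦ (W.baseChange K).torsionGaloisModuleReduce_surjective p j) j) (Sum.inr v)) c y ∈
      (Φ.ordinaryCore hm (j + 1)).map
        (cd.transportH1 (κ.eisensteinTwist ((W.baseChange K).torsionGaloisModule ((p : ℤ) ^ (j + 1))) hm (j + 1)) v) := by
  letI := IwasawaAlgebra.isLocalRing_quotient_X_pow_add_C p hm
  obtain ⟨x, hx, rfl⟩ := hy
  exact ⟨_, Φ.scalarMapH1_mem_ordinaryCore hm (j + 1) c hx, W.transportH1_scalarMapH1_eisensteinTower κ hm cd v j c x⟩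

end WeierstrassCurve

end
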